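/-
Copyright: the b2b-balaban T⁴-continuum CRUX team, row NE7b OWNER lineage `t4-ne7b-p1` (gen 125). Project licence.
-/
import Summits.QuantumFields.BalabanUV.T4Continuum.Spine.NE7b.SupZdCoarseTorusSeam

/-!
# THE TORUS `H + K` COLUMN, LIFTED TO `ℤ^d`, SOLVES THE TRUNCATED-KERNEL EQUATION UP TO A SOURCE OFF THE WINDOW — AND SO DOES THE
# `ℤ^d` COLUMN, UP TO AN EXPONENTIALLY SMALL SOURCE: for a `ℤ^d` kernel `|K(p,q)| ≤ εe^{−γ|p−q|₁}` read on the fine torus `T = Site d ((n+1)s)`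
# as `K_T(x,z) = K(wm x, wm z)`, a torus solution `ψ` of `(H[V_t] + K_T)ψ = f_t`, lifted as `u = ψ∘σ`, satisfies ON `ℤ^d`
# `(H_{V_t∘σ} + K^W)u = f_t∘σ + g₁` with the TRUNCATED kernel `K^W(p,q) = 𝟙[q ∈ window]K(p,q)` (in the class), `g₁ = 0` on the window and
# `|g₁| ≤ 2εK_γ‖ψ‖_∞`; and a bounded `ℤ^d` solution `Ψ` of `(H_V + K)Ψ = f` satisfies `(H_V + K^W)Ψ = f + g₂` with
# `|g₂| ≤ εK_γ·C_Ψe^{−μR}` whenever `|Ψ(q)| ≤ C_Ψe^{−μ|blk n q − c|₁}` and every non-window `q` has `|blk n q − c|₁ ≥ R` — the two inputs of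
# (237)'s near data agreement for the torus → `ℤ^d` SEAM of the perturbed block columns: SAME kernel `K^W`, potentials and sources agreeing
# on the deep blocks up to `εK_γC_Ψe^{−μR}` (row NE7b, node U5c; (185)∕(189)∕(197) BY NAME; [folklore])

Cell `pub-balaban`, sub-cell `t4`, spine estimate NE7b (`T4WeightBudget.RelWeightBound`; the cell's OWN estimate — NOT PRINTED in
[Bałaban 1983–89], NOT PROVED).  Crux-route work under `Spine/NE7b/` by the row OWNER (`t4-ne7b-p1` gen 125, file (238)) under FREEZE
(0)'s crux-prover clause; NOTHING of Bałaban's is named as a Lean object, valued or asserted; no `T4Continuum/Support` leaf typed; no `def`,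
no notation (the truncated kernel WRITTEN OUT as `if wm (σ q) = q then K p q else 0`; `σ = siteOf`, `wm = windowMap`); zero `sorry`.
Imports (BY NAME): the OWNER's (197) `…SupZdCoarseTorusSeam` (`windowMap_siteOf_of_deep_block`, `depth_le_dist`; through it (185)
`torus_solution_lifts`, (186) `blockSource_window_reading`, (189) `summable_kernel_row`, `tsum_kernel_row_le`, the torus dictionary
`Beta.{Site, siteOf, windowMap, siteOf_windowMap, windowMap_injective}`, (27) `sum_B`), Mathlib's `tsum_eq_sum`, `Finset.sum_image`,
`Summable.tsum_add`.

WHY (located).  The torus → `ℤ^d` identification of the `H + K` next-scale Hessian ((236) gave its `ℤ^d` half) needs the SEAM estimate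
`|T^{tor}_K(σ b, σ c) − T_K(b,c)| → 0` for deep `b, c`, i.e. `|ψ^{K}_{σc}(σ p) − Ψ^K_c(p)|` small on deep blocks.  (197) did the linear column by
lifting the torus column to `ℤ^d` ((185): the lift solves the `ℤ^d` equation with periodised data EXACTLY) and (196)'s data agreement.
With a nonlocal `K` the lift's kernel term `Σ_{z ∈ T}K(wm σp, wm z)ψ(z)` is the `ℤ^d` series of the WINDOW-TRUNCATED kernel `K^W` read at the
periodic image `wm σp` (§1: the window is the image of `wm`, a bijection onto the torus), which is not a decaying `ℤ^d` kernel in `p`;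
but `K^W(p,·)` itself IS (truncation only deletes entries), and the two agree at window points — so the lift solves the `K^W`-equation
with a source defect `g₁` supported OFF the window (§3).  Symmetrically the `ℤ^d` column solves the `K^W`-equation with the defect
`−Σ_{q ∉ W}K(p,q)Ψ(q)`, uniformly small when `Ψ` decays away from a deep centre (§4).  (237) then compares the two (the sequel).

WHAT IS PROVED ([folklore]; `N = (n+1)s`, `σ = siteOf d N`, `wm = windowMap d N`): §1 **`torus_kernel_as_series`** (`Σ_{z : T}K(p′, wm z)ψ z =
Σ′_q𝟙[wm σq = q]K(p′,q)ψ(σq)`), `truncated_kernel_decay`; §2 **`perturbed_torus_solution_lifts`** (the lift solves the `ℤ^d` equation with the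
kernel `q ↦ 𝟙[wm σq = q]K(wm σp, q)` EXACTLY); §3 **`lift_truncated_equation`** (`∃ g₁`: zero on the window, `|g₁| ≤ 2εK_γB_u`, and
`(H_{V_t∘σ} + K^W)u = f_t∘σ + g₁`); §4 **`column_truncated_equation`** (`(H_V + K^W)Ψ = f + g₂`, `|g₂| ≤ εK_γC_Ψe^{−μR}`); §5
`torus_coarse_entry_reading` (for deep `b`: `T^{tor}(σ_s b, y′) = (n+1)^{−d}Σ_{q ∈ B n b}ψ_{y′}(σ q)`); §6 toy.

HONEST (what this is NOT).  Bookkeeping identities and two source bounds; the seam estimate, [B4] (5.6)∕(5.9) on the torus and the limit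
`(T^{tor}_K)⁻¹ → N_K` are the sequel; scalar skeleton ((A3), NC-NE7b-α UNRULED); nothing of the covariant propagators of [B4]–[B6]; nothing of
Bałaban's asserted.  BY-NAME EFFECT ON THE WALL: NONE.  NE7b NOT PRINTED ∕ NOT PROVED; spine PROVED 0∕9; rung (B)+1 — the programme's
measures remain FINITE-torus statements; NOT the mass gap, NOT Clay.  HONEST DEPENDENCY: continuum YM on T⁴ ⇐ BetaPertH ∧ nine spine
estimates (0∕9 proved); BetaPertH ⇐ (D1) ∧ (D4) ∧ CAP+tail; G-an2-4 gates asym, D1 and NE2∕3∕4.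
-/

set_option autoImplicit false

noncomputable section

namespace Summit.QuantumFields.BalabanUV.T4Continuum.NE7b.SupZdPerturbedTorusLift

open Real Filter Topology
open Literature.MathematicalPhysics.QuantumFieldTheory.Balaban1983to89
open B6QGQLower276 (X e blk B chart mem_B sum_B sum_B_const blk_chart)
open Beta (Site siteOf windowMap siteOf_windowMap windowMap_injective)
open SupZdExponentialSums (summable_kernel_row tsum_kernel_row_le)
open SupZdPropagatorPeriodic (torus_solution_lifts)
open SupZdCoarseTorusSeam (windowMap_siteOf_of_deep windowMap_siteOf_of_deep_block depth_le_dist)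

variable {d : ℕ}

/-! ## §1. The torus kernel term as a `ℤ^d` series of the window-truncated kernel -/

/-- **A TORUS SUM IS A WINDOW SUM IS A `ℤ^d` SERIES**: `Σ_{z : T}K(p′, wm z)ψ(z) = Σ′_{q ∈ ℤ^d}𝟙[wm(σ q) = q]K(p′,q)ψ(σ q)` — the window
`{q : wm(σ q) = q}` is the injective image of `wm`, on which `σ` inverts it. [folklore] -/
theorem torus_kernel_as_series (N : ℕ) [NeZero N] (K : X d → X d → ℝ) (ψ : Site d N → ℝ) (p' : X d) :
    ∑ z : Site d N, K p' (windowMap d N z) * ψ z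
      = ∑' q : X d, (if windowMap d N (siteOf d N q) = q then K p' q else 0) * ψ (siteOf d N q) := by
  classical
  have hzero : ∀ q : X d, q ∉ (Finset.univ : Finset (Site d N)).image (windowMap d N) →
      (if windowMap d N (siteOf d N q) = q then K p' q else 0) * ψ (siteOf d N q) = 0 := by
    intro q hq
    rw [if_neg (fun h => hq (Finset.mem_image.2 ⟨siteOf d N q, Finset.mem_univ _, h⟩)), zero_mul]
  rw [tsum_eq_sum (s := (Finset.univ : Finset (Site d N)).image (windowMap d N)) hzero,
    Finset.sum_image fun z _ z' _ h => windowMap_injective d N h]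
  refine Finset.sum_congr rfl fun z _ => ?_
  rw [siteOf_windowMap, if_pos rfl]

/-- The window-truncated kernel is in the class: `|𝟙[wm σq = q]K(p,q)| ≤ εe^{−γ|p−q|₁}`; so is its complement. [folklore] -/
theorem truncated_kernel_decay (N : ℕ) [NeZero N] {ε γ : ℝ} (K : X d → X d → ℝ)
    (hK : ∀ p q, |K p q| ≤ ε * exp (-(γ * ∑ i, (((p i - q i).natAbs : ℕ) : ℝ)))) (p q : X d) :
    |(if windowMap d N (siteOf d N q) = q then K p q else 0)| ≤ ε * exp (-(γ * ∑ i, (((p i - q i).natAbs : ℕ) : ℝ))) ∧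
    |(if windowMap d N (siteOf d N q) = q then 0 else K p q)| ≤ ε * exp (-(γ * ∑ i, (((p i - q i).natAbs : ℕ) : ℝ))) := by
  have h0 : (0 : ℝ) ≤ ε * exp (-(γ * ∑ i, (((p i - q i).natAbs : ℕ) : ℝ))) := (abs_nonneg _).trans (hK p q)
  constructor <;> split_ifs <;> first | exact hK p q | (rw [abs_zero]; exact h0)

/-! ## §2. The lift of a torus `H + K` solution -/

/-- **THE LIFT OF A TORUS SOLUTION OF `H[V_t] + K_T` SOLVES A `ℤ^d` EQUATION EXACTLY**: with `K_T(x,z) = K(wm x, wm z)`, `u = ψ∘σ` satisfies at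
every `p ∈ ℤ^d` the displayed `ℤ^d` stencil∕block∕potential terms with data `V_t∘σ` ((185)) plus the kernel series of `q ↦ 𝟙[wm σq = q]K(wm σp, q)`
against `u`, equal to `f_t(σ p)`. [folklore] -/
theorem perturbed_torus_solution_lifts (n : ℕ) (a : ℝ) (s : ℕ) [NeZero s] (K : X d → X d → ℝ) (V u f : Site d ((n + 1) * s) → ℝ)
    (hu : ∀ x, ((n : ℝ) + 1) ^ 2 * ∑ μ, (2 * u x - u (x + siteOf d ((n + 1) * s) (e μ)) - u (x - siteOf d ((n + 1) * s) (e μ)))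
      + a / ((n : ℝ) + 1) ^ d * ∑ q ∈ B n (blk n (windowMap d ((n + 1) * s) x)), u (siteOf d ((n + 1) * s) q) + V x * u x
      + ∑ z, K (windowMap d ((n + 1) * s) x) (windowMap d ((n + 1) * s) z) * u z = f x) (p : X d) :
    ((n : ℝ) + 1) ^ 2 * ∑ μ, (2 * u (siteOf d ((n + 1) * s) p) - u (siteOf d ((n + 1) * s) (p + e μ)) - u (siteOf d ((n + 1) * s) (p - e μ)))
      + a / ((n : ℝ) + 1) ^ d * ∑ q ∈ B n (blk n p), u (siteOf d ((n + 1) * s) q)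
      + V (siteOf d ((n + 1) * s) p) * u (siteOf d ((n + 1) * s) p)
      + ∑' q : X d, (if windowMap d ((n + 1) * s) (siteOf d ((n + 1) * s) q) = q
          then K (windowMap d ((n + 1) * s) (siteOf d ((n + 1) * s) p)) q else 0) * u (siteOf d ((n + 1) * s) q)
      = f (siteOf d ((n + 1) * s) p) := by
  -- move the kernel term into the source and lift the `H` part by (185)
  have hu' : ∀ x, ((n : ℝ) + 1) ^ 2 * ∑ μ, (2 * u x - u (x + siteOf d ((n + 1) * s) (e μ)) - u (x - siteOf d ((n + 1) * s) (e μ)))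
      + a / ((n : ℝ) + 1) ^ d * ∑ q ∈ B n (blk n (windowMap d ((n + 1) * s) x)), u (siteOf d ((n + 1) * s) q) + V x * u x
      = f x - ∑ z, K (windowMap d ((n + 1) * s) x) (windowMap d ((n + 1) * s) z) * u z := fun x => by
    rw [← hu x]; ring
  have h := torus_solution_lifts n a s V u (fun x => f x - ∑ z, K (windowMap d ((n + 1) * s) x) (windowMap d ((n + 1) * s) z) * u z) hu' p
  rw [← torus_kernel_as_series]
  linarith [h]

/-! ## §3. The lift solves the truncated-kernel equation up to a source off the window -/

/-- **THE LIFT AND THE TRUNCATED KERNEL `K^W(p,q) = 𝟙[q ∈ W]K(p,q)`**: `∃ g₁ : ℤ^d → ℝ` with `g₁(p) = 0` whenever `wm(σ p) = p` (window points),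
`|g₁| ≤ 2εK_γB_u`, and `(H_{V_t∘σ} + K^W)(ψ∘σ) = f_t∘σ + g₁` on `ℤ^d` — `g₁(p) = Σ′_q(K^W(p,q) − K^W(wm σp, q))ψ(σ q)`, two absolutely convergent
rows ((189)). [folklore] -/
theorem lift_truncated_equation (n : ℕ) (a : ℝ) (s : ℕ) [NeZero s] {ε γ Bu : ℝ} (hγ : 0 < γ) (K : X d → X d → ℝ)
    (hK : ∀ p q, |K p q| ≤ ε * exp (-(γ * ∑ i, (((p i - q i).natAbs : ℕ) : ℝ)))) (V u f : Site d ((n + 1) * s) → ℝ)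
    (huB : ∀ x, |u x| ≤ Bu)
    (hu : ∀ x, ((n : ℝ) + 1) ^ 2 * ∑ μ, (2 * u x - u (x + siteOf d ((n + 1) * s) (e μ)) - u (x - siteOf d ((n + 1) * s) (e μ)))
      + a / ((n : ℝ) + 1) ^ d * ∑ q ∈ B n (blk n (windowMap d ((n + 1) * s) x)), u (siteOf d ((n + 1) * s) q) + V x * u x
      + ∑ z, K (windowMap d ((n + 1) * s) x) (windowMap d ((n + 1) * s) z) * u z = f x) :
    ∃ g₁ : X d → ℝ,
      (∀ p, windowMap d ((n + 1) * s) (siteOf d ((n + 1) * s) p) = p → g₁ p = 0) ∧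
      (∀ p, |g₁ p| ≤ 2 * (ε * (2 * (1 - exp (-γ))⁻¹) ^ d * Bu)) ∧
      (∀ p, ((n : ℝ) + 1) ^ 2 * ∑ μ, (2 * u (siteOf d ((n + 1) * s) p) - u (siteOf d ((n + 1) * s) (p + e μ))
          - u (siteOf d ((n + 1) * s) (p - e μ)))
        + a / ((n : ℝ) + 1) ^ d * ∑ q ∈ B n (blk n p), u (siteOf d ((n + 1) * s) q)
        + V (siteOf d ((n + 1) * s) p) * u (siteOf d ((n + 1) * s) p)
        + ∑' q : X d, (if windowMap d ((n + 1) * s) (siteOf d ((n + 1) * s) q) = q then K p q else 0) * u (siteOf d ((n + 1) * s) q)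
        = f (siteOf d ((n + 1) * s) p) + g₁ p) := by
  classical
  obtain ⟨KW, hKW⟩ : ∃ KW : X d → X d → ℝ, ∀ p q, KW p q =
      if windowMap d ((n + 1) * s) (siteOf d ((n + 1) * s) q) = q then K p q else 0 := ⟨_, fun _ _ => rfl⟩
  have hKWd : ∀ p q, |KW p q| ≤ ε * exp (-(γ * ∑ i, (((p i - q i).natAbs : ℕ) : ℝ))) := fun p q => by
    rw [hKW]; exact (truncated_kernel_decay ((n + 1) * s) K hK p q).1
  have hul : ∀ q : X d, |u (siteOf d ((n + 1) * s) q)| ≤ Bu := fun q => huB _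
  refine ⟨fun p => ∑' q : X d, KW p q * u (siteOf d ((n + 1) * s) q)
      - ∑' q : X d, KW (windowMap d ((n + 1) * s) (siteOf d ((n + 1) * s) p)) q * u (siteOf d ((n + 1) * s) q),
    fun p hp => by dsimp only; rw [hp, sub_self], fun p => ?_, fun p => ?_⟩
  · have h1 := tsum_kernel_row_le hγ KW hKWd (fun q => u (siteOf d ((n + 1) * s) q)) hul p
    have h2 := tsum_kernel_row_le hγ KW hKWd (fun q => u (siteOf d ((n + 1) * s) q)) hul
      (windowMap d ((n + 1) * s) (siteOf d ((n + 1) * s) p))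
    calc _ ≤ |∑' q : X d, KW p q * u (siteOf d ((n + 1) * s) q)|
          + |∑' q : X d, KW (windowMap d ((n + 1) * s) (siteOf d ((n + 1) * s) p)) q * u (siteOf d ((n + 1) * s) q)| := abs_sub _ _
      _ ≤ _ := by linarith
  · have h := perturbed_torus_solution_lifts n a s K V u f hu p
    simp only [← hKW] at h ⊢
    linarith

/-! ## §4. The `ℤ^d` column solves the truncated-kernel equation up to an exponentially small source -/

/-- **THE `ℤ^d` SOLUTION AND THE TRUNCATED KERNEL**: `Ψ` bounded with `(H_V + K)Ψ = f` ⟹ `(H_V + K^W)Ψ = f + g₂`,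
`g₂(p) = −Σ′_q𝟙[q ∉ W]K(p,q)Ψ(q)`; and if `|Ψ(q)| ≤ C_Ψe^{−μ|blk n q − c|₁}` (`μ ≥ 0`) with `R ≤ |blk n q − c|₁` for every non-window `q`, then
`|g₂| ≤ εK_γ·C_Ψe^{−μR}`. [folklore] -/
theorem column_truncated_equation (n : ℕ) (a : ℝ) (N : ℕ) [NeZero N] {ε γ BΨ : ℝ} (hγ : 0 < γ) (K : X d → X d → ℝ)
    (hK : ∀ p q, |K p q| ≤ ε * exp (-(γ * ∑ i, (((p i - q i).natAbs : ℕ) : ℝ)))) (V Ψ f : X d → ℝ) (hΨB : ∀ q, |Ψ q| ≤ BΨ)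
    (hΨ : ∀ p, ((n : ℝ) + 1) ^ 2 * ∑ μ, (2 * Ψ p - Ψ (p + e μ) - Ψ (p - e μ))
      + a / ((n : ℝ) + 1) ^ d * ∑ q ∈ B n (blk n p), Ψ q + V p * Ψ p + ∑' q : X d, K p q * Ψ q = f p) :
    (∀ p, ((n : ℝ) + 1) ^ 2 * ∑ μ, (2 * Ψ p - Ψ (p + e μ) - Ψ (p - e μ))
      + a / ((n : ℝ) + 1) ^ d * ∑ q ∈ B n (blk n p), Ψ q + V p * Ψ p
      + ∑' q : X d, (if windowMap d N (siteOf d N q) = q then K p q else 0) * Ψ q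
      = f p + -∑' q : X d, (if windowMap d N (siteOf d N q) = q then 0 else K p q) * Ψ q) ∧
    (∀ (c : X d) (CΨ μ R : ℝ), 0 ≤ μ → (∀ q, |Ψ q| ≤ CΨ * exp (-(μ * ∑ i, (((blk n q i - c i).natAbs : ℕ) : ℝ)))) →
      (∀ q, windowMap d N (siteOf d N q) ≠ q → R ≤ ∑ i, (((blk n q i - c i).natAbs : ℕ) : ℝ)) →
      ∀ p, |(-∑' q : X d, (if windowMap d N (siteOf d N q) = q then 0 else K p q) * Ψ q)|
        ≤ ε * (2 * (1 - exp (-γ))⁻¹) ^ d * (CΨ * exp (-(μ * R)))) := by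
  classical
  have hin : ∀ p, Summable fun q : X d => (if windowMap d N (siteOf d N q) = q then K p q else 0) * Ψ q := fun p =>
    summable_kernel_row hγ _ (fun p q => (truncated_kernel_decay N K hK p q).1) Ψ hΨB p
  have hout : ∀ p, Summable fun q : X d => (if windowMap d N (siteOf d N q) = q then 0 else K p q) * Ψ q := fun p =>
    summable_kernel_row hγ _ (fun p q => (truncated_kernel_decay N K hK p q).2) Ψ hΨB p
  refine ⟨fun p => ?_, fun c CΨ μ R hμ hΨd hR p => ?_⟩
  · have hsplit : ∑' q : X d, K p q * Ψ q = ∑' q : X d, (if windowMap d N (siteOf d N q) = q then K p q else 0) * Ψ q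
        + ∑' q : X d, (if windowMap d N (siteOf d N q) = q then 0 else K p q) * Ψ q := by
      rw [← (hin p).tsum_add (hout p)]
      exact tsum_congr fun q => by split_ifs <;> ring
    have h := hΨ p
    rw [hsplit] at h
    linarith
  · -- the complement kernel against `Ψ` is the full kernel against `Ψ𝟙_{W^c}`, which is `≤ C_Ψe^{−μR}`
    have hCΨ : 0 ≤ CΨ := by
      have h := (abs_nonneg _).trans (hΨd c)
      exact le_of_mul_le_mul_right (by rw [zero_mul]; exact h) (exp_pos _)
    have e : ∀ q, (if windowMap d N (siteOf d N q) = q then 0 else K p q) * Ψ q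
        = K p q * (if windowMap d N (siteOf d N q) = q then 0 else Ψ q) := fun q => by split_ifs <;> ring
    have hg : ∀ q, |(if windowMap d N (siteOf d N q) = q then 0 else Ψ q)| ≤ CΨ * exp (-(μ * R)) := by
      intro q
      split_ifs with h
      · rw [abs_zero]; positivity
      · exact (hΨd q).trans (mul_le_mul_of_nonneg_left (exp_le_exp.2 (neg_le_neg (mul_le_mul_of_nonneg_left (hR q h) hμ))) hCΨ)
    rw [abs_neg, tsum_congr e]
    exact tsum_kernel_row_le hγ K hK _ hg p

/-! ## §5. Reading a torus coarse entry with a deep row index through the window -/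

/-- **A DEEP ROW OF THE TORUS COARSE OPERATOR READS ON `ℤ^d`**: for `2|b i| + 4 < 3^k` the torus block of `σ_k b` is the window image of the
`ℤ^d` block `B n b`, so `(n+1)^{−d}Σ_zψ(σ(chart n (wm σ b) z)) = (n+1)^{−d}Σ_{q ∈ B n b}ψ(σ q)`. [folklore] -/
theorem torus_coarse_entry_reading (n k : ℕ) (ψ : Site d ((n + 1) * 3 ^ k) → ℝ) (b : X d)
    (hb : ∀ i, 2 * |b i| + 4 < ((3 ^ k : ℕ) : ℤ)) :
    (((n : ℝ) + 1) ^ d)⁻¹ * ∑ z : Fin d → Fin (n + 1), ψ (siteOf d ((n + 1) * 3 ^ k) (chart n (windowMap d (3 ^ k) (siteOf d (3 ^ k) b)) z))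
      = (((n : ℝ) + 1) ^ d)⁻¹ * ∑ q ∈ B n b, ψ (siteOf d ((n + 1) * 3 ^ k) q) := by
  rw [windowMap_siteOf_of_deep k b hb, sum_B b (fun q => ψ (siteOf d ((n + 1) * 3 ^ k) q))]

/-- **NON-WINDOW FINE POINTS LIE IN NON-DEEP BLOCKS, FAR FROM DEEP CENTRES**: `wm(σ q) ≠ q` ⟹ `|blk n q − c|₁ ≥ 3^k∕2 − 2 − |c|₁`. [folklore] -/
theorem nonwindow_block_far (n k : ℕ) (q c : X d)
    (hq : windowMap d ((n + 1) * 3 ^ k) (siteOf d ((n + 1) * 3 ^ k) q) ≠ q) :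
    ((3 ^ k : ℕ) : ℝ) / 2 - 2 - ∑ j, (((c j).natAbs : ℕ) : ℝ) ≤ ∑ j, (((blk n q j - c j).natAbs : ℕ) : ℝ) := by
  have hnd : ¬ ∀ i, 2 * |blk n q i| + 4 < ((3 ^ k : ℕ) : ℤ) := fun h => hq (windowMap_siteOf_of_deep_block n k q h)
  have h := depth_le_dist k c (blk n q) hnd
  rw [SupZdCoarseForm.natAbs_sub_comm_sum] at h
  exact h

/-! ## §6. Toy -/

/-- Toy (`d = 1`, `N = 3`): the torus sum of the zero kernel is the zero series. -/
example (ψ : Site 1 3 → ℝ) (p' : X 1) :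
    ∑ z : Site 1 3, (fun _ _ => (0 : ℝ)) p' (windowMap 1 3 z) * ψ z
      = ∑' q : X 1, (if windowMap 1 3 (siteOf 1 3 q) = q then (fun _ _ => (0 : ℝ)) p' q else 0) * ψ (siteOf 1 3 q) :=
  torus_kernel_as_series 3 (fun _ _ => (0 : ℝ)) ψ p'

end Summit.QuantumFields.BalabanUV.T4Continuum.NE7b.SupZdPerturbedTorusLift
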